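import Summits.HodgeConjecture.HodgeConjecture.Theses.AnchorTransport
import Literature.AlgebraicGeometry.HodgeTheory.ComplexConjugationHolds

/-!
# Route AnchorTransport — `HodgeModels` (item stmt-HodgeConjecture-1943)

The shared support item `HodgeModels` (`∀ n X, nonempty_hodgeModel n X`: every smooth projective
complex variety of dimension `n` has a Hodge model — Serre's analytification, a natural complex
de Rham comparison and the Hodge decomposition) is the first antecedent of this route's `Assembly`
and conjunct 1 of `HodgeConjectureFor`.  The Literature named fact `nonempty_hodgeModel n X` is now
discharged in tree (`Literature.AlgebraicGeometry.HodgeTheory.nonempty_hodgeModel_holds`, file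
`HodgeTheory/ComplexConjugationHolds`, resting on `Motives.isInternal_hodgePQ_holds`), so the item
closes in one line, exactly as its docstring prescribes.
-/

-- `Summit.HodgeConjecture.HodgeConjecture.Theorems` is the mandated namespace (single-problem summit:
-- Problem = Summit), which `linter.dupNamespace` flags on every declaration; the lakefile turns the
-- linter off tree-wide (weak option), restated here so stand-alone elaboration is warning-free too.
set_option linter.dupNamespace false

namespace Summit.HodgeConjecture.HodgeConjecture.Theorems

/-- **Item stmt-HodgeConjecture-1943 (`HodgeModels`), `AnchorTransport` copy**: for every `n` and
every `X : SchemeOver ℂ`, `nonempty_hodgeModel n X` (if `X` is smooth projective of dimension `n`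
then `Nonempty (HodgeModel n X)`), by the Literature discharge `nonempty_hodgeModel_holds`
(Serre GAGA §2 analytification + de Rham + Hodge decomposition of compact Kähler manifolds).
The type is literally the route decl
`Summit.HodgeConjecture.HodgeConjecture.Theses.AnchorTransport.HodgeModels`.
[cite: SerreGAGA1956, §2 n°5 Prop. 2] [cite: VoisinHodgeI2002, §6.1.3 Prop. 6.11] -/
theorem anchorTransport_hodgeModels_proof :
    Summit.HodgeConjecture.HodgeConjecture.Theses.AnchorTransport.HodgeModels := by
  unfold Summit.HodgeConjecture.HodgeConjecture.Theses.AnchorTransport.HodgeModels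
  intro n X
  exact Literature.AlgebraicGeometry.HodgeTheory.nonempty_hodgeModel_holds

end Summit.HodgeConjecture.HodgeConjecture.Theorems
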